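import Literature.MeasureTheory.Hausdorff.ConeVolume
import Literature.MeasureTheory.Hausdorff.SphereMeasure
import HarnessLib

/-!
# The area of the round `2`-sphere: `μHE[2] (S²) = 4π`

Support file (all results proved) for the flux-limit definitions of the ADM energy
(`Literature.Geometry.Lorentzian.AFEnd.admEnergyFlux`, `AFEnd.HasADMEnergy` in
`Literature/Geometry/Lorentzian/AsymptoticFlatness.lean`), which integrate over coordinate spheres
of `ℝ³` against Mathlib's Euclidean (normalised) Hausdorff measure `μHE[2]`: every *numerical*
value of an ADM energy (`Bray2001_harmonicallyFlatMass_hasADMEnergy` in `HarmonicallyFlat.lean`,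
`Schwarzschild.hasADMEnergy_timeSymmetricExteriorData` in `ModelData.lean`) needs the value
`μHE[2] {‖x‖ = r} = 4π r²`, which is not in Mathlib (no area formula; even the normalising
constant of `μHE[d]` is a `proof_wanted`) and was left open in `SphereMeasure.lean` (there:
`(μHE[d]).comap Subtype.val = κ • volume.toSphere` on the unit sphere with
`κ = μHE[d] (S) / volume.toSphere S`, "in truth `κ = 1`").

We prove `κ = 1` in dimension `3` without any area formula, by squeezing small spherical caps:

* `cap v c = {‖x‖ = 1, ⟪v, x⟫ > c}` (`0 < c < 1`, `‖v‖ = 1`) projects `1`-Lipschitz onto the disc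
  of radius `ρ = √(1 - c²)` of the plane `vᗮ` and is the image of that disc under the graph map
  `y ↦ y + √(1 - ‖y‖²) v`, which is `(1 + ρ/c)`-Lipschitz there; Lipschitz maps increase `μH[2]`
  at most by the square of the constant (Mathlib `LipschitzOnWith.hausdorffMeasure_image_le`), and
  `μHE[2]` of a planar disc is its area `π ρ²` (`μHE[2] = volume` on a `2`-plane), so
  `π(1 - c²) ≤ μHE[2] (cap) ≤ (1 + ρ/c)² π (1 - c²)`
  (`le_euclideanHausdorffMeasure_cap`, `euclideanHausdorffMeasure_cap_le` in `SphericalCap.lean`);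
* `volume.toSphere (cap) = 3 · vol ((0,1) • cap)` (Mathlib `Measure.toSphere_apply'`), and the
  solid sector `(0,1) • cap` is squeezed between the right circular cones of slope `ρ/c` and
  heights `c` and `1`, whose volumes `π t² H³/3` are computed by Cavalieri's principle in
  coordinates adapted to `v` (`volume_cone` in `ConeVolume.lean`), so `π(1 - c²) c ≤ 3 vol ((0,1) • cap) ≤ π(1 - c²)/c²`;
* hence `c² ≤ κ ≤ (1 + ρ/c)²/c` for every `c ∈ (0,1)`, and `c → 1` gives `κ = 1`
  (`euclideanHausdorffMeasure_unitSphere`: `μHE[2] (S²) = volume.toSphere S² = 3 vol(B³) = 4π`).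

Consequences: `euclideanHausdorffMeasure_sphere` (`μHE[2] {‖x‖ = r} = 4π r²`),
`comap_euclideanHausdorff_eq_toSphere` (`κ = 1`), `setIntegral_sphere_euclideanHausdorff_three`
(`∫_{‖x‖ = r} f dμHE[2] = r² • sphereIntegral volume f r`) and `setIntegral_sphere_const`.

## References

* H. Federer, *Geometric measure theory* (1969), 3.2.3 (area formula; here avoided), 2.10.11.
* P. Mattila, *Geometry of sets and measures in Euclidean spaces* (1995), Thm. 3.4, §4.3.
-/

noncomputable section

open Set Metric Module Submodule Filter
open _root_.MeasureTheory _root_.MeasureTheory.Measure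
open scoped ENNReal NNReal Topology RealInnerProductSpace Pointwise

namespace Literature.MeasureTheory.Hausdorff

variable {E : Type*} [NormedAddCommGroup E] [InnerProductSpace ℝ E] [FiniteDimensional ℝ E]
  [MeasurableSpace E] [BorelSpace E]
/-! ### Assembly: `κ = 1` and the area of the sphere -/

section Main

omit [FiniteDimensional ℝ E] [MeasurableSpace E] [BorelSpace E] in
/-- The cap as the image of the corresponding subset of the sphere subtype. [folklore] -/
theorem image_val_capSub (v : E) (c : ℝ) :
    (Subtype.val : sphere (0 : E) 1 → E) '' {ω : sphere (0 : E) 1 | c < ⟪v, (ω : E)⟫} = cap v c := by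
  ext x
  constructor
  · rintro ⟨ω, hω, rfl⟩
    exact ⟨mem_sphere_zero_iff_norm.1 ω.2, hω⟩
  · rintro ⟨hx1, hxc⟩
    exact ⟨⟨x, mem_sphere_zero_iff_norm.2 hx1⟩, hxc, rfl⟩

omit [FiniteDimensional ℝ E] in
/-- Caps are measurable in the sphere subtype (open). [folklore] -/
theorem measurableSet_capSub (v : E) (c : ℝ) :
    MeasurableSet {ω : sphere (0 : E) 1 | c < ⟪v, (ω : E)⟫} :=
  (isOpen_lt continuous_const (continuous_const.inner continuous_subtype_val)).measurableSet

/-- The proportionality `σ = κ • τ` of `SphereMeasure.lean` evaluated on a cap: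
`μHE[2] (cap v c) = κ · 3 · vol ((0,1) • cap v c)` in dimension `3`. [folklore] -/
theorem euclideanHausdorffMeasure_cap_eq (hE : finrank ℝ E = 3) (v : E) (c : ℝ) :
    (μHE[2] : Measure E) (cap v c) =
      ((μHE[2] : Measure E) (sphere 0 1) / (volume : Measure E).toSphere univ) *
        (3 * volume (Ioo (0 : ℝ) 1 • cap v c)) := by
  have h := comap_euclideanHausdorff_eq_smul_toSphere (E := E) (d := 2) hE
  have hme := MeasurableEmbedding.subtype_coe
    ((isClosed_sphere : IsClosed (sphere (0 : E) 1)).measurableSet)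
  have hC := measurableSet_capSub v c
  have h1 := congrArg (fun μ : Measure (sphere (0 : E) 1) ↦ μ {ω | c < ⟪v, (ω : E)⟫}) h
  simp only [Measure.smul_apply, smul_eq_mul] at h1
  rw [hme.comap_apply, image_val_capSub, Measure.toSphere_apply' _ hC, image_val_capSub, hE] at h1
  exact_mod_cast h1

/-- `volume.toSphere S² = 3 · vol (B³) = 4π` in dimension `3`. [folklore] -/
theorem toSphere_volume_univ_three (hE : finrank ℝ E = 3) :
    (volume : Measure E).toSphere univ = ENNReal.ofReal (4 * Real.pi) := by
  rw [Measure.toSphere_apply_univ,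
    InnerProductSpace.volume_ball_of_dim_odd (k := 1) (by simpa using hE) (0 : E) 1, hE,
    ENNReal.ofReal_one, one_pow, one_mul, ← ENNReal.ofReal_natCast,
    ← ENNReal.ofReal_mul (Nat.cast_nonneg _)]
  congr 1
  simp [Nat.doubleFactorial]
  ring

/-- **The squeeze**: in dimension `3`, the constant `κ = μHE[2] (S²) / volume.toSphere S²`
satisfies `c² ≤ κ ≤ (1 + √(1 - c²)/c)²/c` for every `0 < c < 1`. [folklore] -/
theorem sq_le_kappa_le (hE : finrank ℝ E = 3) {c : ℝ} (hc0 : 0 < c) (hc1 : c < 1) :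
    c ^ 2 ≤ ((μHE[2] : Measure E) (sphere 0 1) / (volume : Measure E).toSphere univ).toReal ∧
    ((μHE[2] : Measure E) (sphere 0 1) / (volume : Measure E).toSphere univ).toReal ≤
      (1 + Real.sqrt (1 - c ^ 2) / c) ^ 2 / c := by
  set b : OrthonormalBasis (Fin 3) ℝ E := (stdOrthonormalBasis ℝ E).reindex (finCongr hE)
  set v : E := b 2 with hv_def
  have hv : ‖v‖ = 1 := b.orthonormal.1 2
  haveI : Fact (finrank ℝ E = 2 + 1) := ⟨hE⟩
  have hv0 : v ≠ 0 := by
    intro h; rw [h, norm_zero] at hv; exact zero_ne_one hv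
  have hK : finrank ℝ (ℝ ∙ v)ᗮ = 2 := Submodule.finrank_orthogonal_span_singleton hv0
  set κ := (μHE[2] : Measure E) (sphere 0 1) / (volume : Measure E).toSphere univ with hκ_def
  have hκ : κ ≠ ⊤ := euclideanHausdorff_div_toSphere_ne_top hE
  have hP : 0 < Real.pi * (1 - c ^ 2) := mul_pos Real.pi_pos (by nlinarith)
  have hc2 : 0 < c ^ 2 := by positivity
  have heq := euclideanHausdorffMeasure_cap_eq hE v c
  constructor
  · -- lower bound for `σ(cap)`, upper bound for the cone
    have h1 := le_euclideanHausdorffMeasure_cap hv hK hc0 hc1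
    have h2 := volume_Ioo_smul_cap_le b hc0 hc1
    have h3 : ENNReal.ofReal (Real.pi * (1 - c ^ 2)) ≤
        κ * (3 * ENNReal.ofReal (Real.pi * (1 - c ^ 2) / (3 * c ^ 2))) := by
      rw [heq] at h1
      exact h1.trans (mul_le_mul_right (mul_le_mul_right h2 3) κ)
    have h4 : κ * (3 * ENNReal.ofReal (Real.pi * (1 - c ^ 2) / (3 * c ^ 2))) ≠ ⊤ :=
      ENNReal.mul_ne_top hκ (ENNReal.mul_ne_top (by simp) ENNReal.ofReal_ne_top)
    have h5 := ENNReal.toReal_mono h4 h3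
    rw [ENNReal.toReal_ofReal hP.le, ENNReal.toReal_mul, ENNReal.toReal_mul,
      ENNReal.toReal_ofReal (by positivity), ENNReal.toReal_ofNat] at h5
    rw [show κ.toReal * (3 * (Real.pi * (1 - c ^ 2) / (3 * c ^ 2))) =
      κ.toReal * (Real.pi * (1 - c ^ 2)) / c ^ 2 by field_simp] at h5
    rw [le_div_iff₀ hc2] at h5
    rw [mul_comm] at h5
    exact le_of_mul_le_mul_right (by linarith) hP
  · -- upper bound for `σ(cap)`, lower bound for the cone
    have h1 := euclideanHausdorffMeasure_cap_le hv hK hc0 hc1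
    have h2 := le_volume_Ioo_smul_cap b hc0 hc1
    have h3 : κ * (3 * ENNReal.ofReal (Real.pi * (1 - c ^ 2) * c / 3)) ≤
        ENNReal.ofReal ((1 + Real.sqrt (1 - c ^ 2) / c) ^ 2) *
          ENNReal.ofReal (Real.pi * (1 - c ^ 2)) := by
      rw [heq] at h1
      exact (mul_le_mul_right (mul_le_mul_right h2 3) κ).trans h1
    have h4 : ENNReal.ofReal ((1 + Real.sqrt (1 - c ^ 2) / c) ^ 2) *
        ENNReal.ofReal (Real.pi * (1 - c ^ 2)) ≠ ⊤ :=
      ENNReal.mul_ne_top ENNReal.ofReal_ne_top ENNReal.ofReal_ne_top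
    have h5 := ENNReal.toReal_mono h4 h3
    rw [ENNReal.toReal_mul, ENNReal.toReal_mul, ENNReal.toReal_mul,
      ENNReal.toReal_ofReal (by positivity), ENNReal.toReal_ofReal (by positivity),
      ENNReal.toReal_ofReal hP.le, ENNReal.toReal_ofNat] at h5
    rw [show κ.toReal * (3 * (Real.pi * (1 - c ^ 2) * c / 3)) =
      κ.toReal * c * (Real.pi * (1 - c ^ 2)) by ring] at h5
    rw [le_div_iff₀ hc0]
    exact le_of_mul_le_mul_right h5 hP

/-- **`κ = 1`**: the Euclidean Hausdorff measure `μHE[2]` of the unit sphere of a `3`-dimensional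
real inner product space equals its polar surface measure `volume.toSphere univ`. [folklore] -/
theorem euclideanHausdorffMeasure_unitSphere_eq_toSphere (hE : finrank ℝ E = 3) :
    (μHE[2] : Measure E) (sphere 0 1) = (volume : Measure E).toSphere univ := by
  set κ := (μHE[2] : Measure E) (sphere 0 1) / (volume : Measure E).toSphere univ with hκ_def
  have hκ : κ ≠ ⊤ := euclideanHausdorff_div_toSphere_ne_top hE
  -- the squeeze in the limit `c → 1⁻`
  have hev : ∀ᶠ c in 𝓝[<] (1 : ℝ), c ^ 2 ≤ κ.toReal ∧
      κ.toReal ≤ (1 + Real.sqrt (1 - c ^ 2) / c) ^ 2 / c := by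
    filter_upwards [Ioo_mem_nhdsLT one_pos] with c hc
    exact sq_le_kappa_le hE hc.1 hc.2
  have hlow : Tendsto (fun c : ℝ ↦ c ^ 2) (𝓝[<] (1 : ℝ)) (𝓝 1) := by
    have : Tendsto (fun c : ℝ ↦ c ^ 2) (𝓝 (1 : ℝ)) (𝓝 (1 ^ 2)) :=
      (continuous_pow 2).continuousAt.tendsto
    rw [one_pow] at this
    exact this.mono_left nhdsWithin_le_nhds
  have hup : Tendsto (fun c : ℝ ↦ (1 + Real.sqrt (1 - c ^ 2) / c) ^ 2 / c) (𝓝[<] (1 : ℝ))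
      (𝓝 1) := by
    have hcont : ContinuousAt (fun c : ℝ ↦ (1 + Real.sqrt (1 - c ^ 2) / c) ^ 2 / c) 1 := by
      fun_prop (disch := norm_num)
    have := hcont.tendsto
    simp only [one_pow, sub_self, Real.sqrt_zero, add_zero, div_one] at this
    exact this.mono_left nhdsWithin_le_nhds
  have h1 : 1 ≤ κ.toReal := le_of_tendsto hlow (hev.mono fun c hc ↦ hc.1)
  have h2 : κ.toReal ≤ 1 := ge_of_tendsto hup (hev.mono fun c hc ↦ hc.2)
  have hk : κ = 1 := by
    rw [← ENNReal.ofReal_toReal hκ, le_antisymm h2 h1, ENNReal.ofReal_one]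
  have hnt : Nontrivial E := Module.nontrivial_of_finrank_pos (R := ℝ) (by omega)
  have hτ0 : (volume : Measure E).toSphere univ ≠ 0 := by
    rw [Ne, measure_univ_eq_zero]
    exact Measure.toSphere_ne_zero _
  rw [hκ_def, ENNReal.div_eq_one_iff hτ0 (measure_ne_top _ _)] at hk
  exact hk

/-- **The area of the unit `2`-sphere**: `μHE[2] (S²) = 4π` for the Euclidean (normalised)
`2`-dimensional Hausdorff measure of a `3`-dimensional real inner product space.
Federer 1969, 3.2.13; here from `κ = 1` and `3 · vol(B³) = 4π`. [folklore] -/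
theorem euclideanHausdorffMeasure_unitSphere (hE : finrank ℝ E = 3) :
    (μHE[2] : Measure E) (sphere 0 1) = ENNReal.ofReal (4 * Real.pi) := by
  rw [euclideanHausdorffMeasure_unitSphere_eq_toSphere hE, toSphere_volume_univ_three hE]

/-- **The area of a round `2`-sphere**: `μHE[2] {‖x‖ = r} = 4π r²` (`r > 0`) in a
`3`-dimensional real inner product space. [folklore] -/
theorem euclideanHausdorffMeasure_sphere (hE : finrank ℝ E = 3) {r : ℝ} (hr : 0 < r) :
    (μHE[2] : Measure E) (sphere 0 r) = ENNReal.ofReal (4 * Real.pi * r ^ 2) := by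
  rw [← smul_unitSphere hr, Measure.euclideanHausdorffMeasure_smul₀ 2 hr.ne',
    euclideanHausdorffMeasure_unitSphere hE, ENNReal.smul_def, smul_eq_mul, ENNReal.coe_pow,
    ← ENNReal.ofReal_coe_nnreal, coe_nnnorm, Real.norm_eq_abs, abs_of_pos hr,
    ← ENNReal.ofReal_pow hr.le, ← ENNReal.ofReal_mul (by positivity)]
  congr 1
  ring

/-- The finite real area: `(μHE[2] {‖x‖ = r}).toReal = 4π r²` (`r > 0`). [folklore] -/
theorem euclideanHausdorffMeasure_sphere_toReal (hE : finrank ℝ E = 3) {r : ℝ} (hr : 0 < r) :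
    ((μHE[2] : Measure E) (sphere 0 r)).toReal = 4 * Real.pi * r ^ 2 := by
  rw [euclideanHausdorffMeasure_sphere hE hr, ENNReal.toReal_ofReal (by positivity)]

/-- **`κ = 1` as measures**: on the unit sphere of a `3`-dimensional real inner product space the
Euclidean Hausdorff measure `μHE[2]` *is* the polar surface measure `volume.toSphere`
(the case `d = 2` of `comap_euclideanHausdorff_eq_smul_toSphere` with the constant evaluated).
[folklore] -/
theorem comap_euclideanHausdorff_eq_toSphere (hE : finrank ℝ E = 3) :
    (μHE[2] : Measure E).comap (Subtype.val : sphere (0 : E) 1 → E) =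
      (volume : Measure E).toSphere := by
  have hnt : Nontrivial E := Module.nontrivial_of_finrank_pos (R := ℝ) (by omega)
  have hτ0 : (volume : Measure E).toSphere univ ≠ 0 := by
    rw [Ne, measure_univ_eq_zero]
    exact Measure.toSphere_ne_zero _
  rw [comap_euclideanHausdorff_eq_smul_toSphere (d := 2) hE,
    euclideanHausdorffMeasure_unitSphere_eq_toSphere hE,
    ENNReal.div_self hτ0 (measure_ne_top _ _), one_smul]

/-- **Hausdorff sphere integrals in polar form, dimension `3`**:
`∫_{‖x‖ = r} f dμHE[2] = r² • ∫ f (r ω) d(volume.toSphere)(ω) = r² • sphereIntegral volume f r`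
(`r > 0`). [folklore] -/
theorem setIntegral_sphere_euclideanHausdorff_three {F : Type*} [NormedAddCommGroup F]
    [NormedSpace ℝ F] (hE : finrank ℝ E = 3) {r : ℝ} (hr : 0 < r) (f : E → F) :
    ∫ x in sphere (0 : E) r, f x ∂(μHE[2] : Measure E) =
      r ^ 2 • Analysis.FluidPDE.sphereIntegral (volume : Measure E) f r := by
  have hnt : Nontrivial E := Module.nontrivial_of_finrank_pos (R := ℝ) (by omega)
  have hτ0 : (volume : Measure E).toSphere univ ≠ 0 := by
    rw [Ne, measure_univ_eq_zero]
    exact Measure.toSphere_ne_zero _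
  rw [setIntegral_sphere_euclideanHausdorff hE hr, euclideanHausdorffMeasure_unitSphere_eq_toSphere hE,
    ENNReal.div_self hτ0 (measure_ne_top _ _), ENNReal.toReal_one, one_mul]

/-- **Integral of a constant over a round sphere**: `∫_{‖x‖ = r} c dμHE[2] = (4π r²) • c`
(`r > 0`). [folklore] -/
theorem setIntegral_sphere_const {F : Type*} [NormedAddCommGroup F] [NormedSpace ℝ F]
    [CompleteSpace F] (hE : finrank ℝ E = 3) {r : ℝ} (hr : 0 < r) (a : F) :
    ∫ _ in sphere (0 : E) r, a ∂(μHE[2] : Measure E) = (4 * Real.pi * r ^ 2) • a := by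
  rw [setIntegral_const, Measure.real, euclideanHausdorffMeasure_sphere_toReal hE hr]

/-- The case of `ℝ³ = EuclideanSpace ℝ (Fin 3)`: `μHE[2] {‖x‖ = r} = 4π r²`. [folklore] -/
theorem euclideanHausdorffMeasure_sphere_fin_three {r : ℝ} (hr : 0 < r) :
    (μHE[2] : Measure (EuclideanSpace ℝ (Fin 3))) (sphere 0 r) =
      ENNReal.ofReal (4 * Real.pi * r ^ 2) :=
  euclideanHausdorffMeasure_sphere (finrank_euclideanSpace_fin (𝕜 := ℝ) (n := 3)) hr

end Main

end Literature.MeasureTheory.Hausdorff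

end
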